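import Literature.NumberTheory.LFunctions.WeilMarkovQuadratic
import Literature.NumberTheory.LFunctions.WeilWindowSuzukiAsymptoticProofs
import Summits.RiemannHypothesis.RiemannHypothesis.Theorems.SemilocalListPoly
import Mathlib.Analysis.SpecialFunctions.Trigonometric.Series
import Mathlib.Analysis.Complex.Exponential
import HarnessLib

/-!
# Semi-local threshold, negative side — a POLYNOMIAL MAJORANT of `t · w(t)` and the exact-rational bound of `∫₀^{2b} w·D`

Cell `rh-explicit` (HOME `run/shared/lean/pub/rh-explicit/`), seat cc-s2-4 (`HOME/cc-s2-4/CC4-THRESHOLD-PLAN.md` §2).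
Honest framing: bookkeeping for NEGATIVE certificates about the tree's `weilSemilocalThreshold {2}`; nothing here
bears on RH.

The archimedean jump density of Bombieri's form of `W_∞` is `w(t) = e^{t/2}/(2 sinh t)`
(`Literature.NumberTheory.LFunctions.weilArchDensity`), `w(t) ~ 1/(2t)` at `0⁺`.  lad-2's rung R3⁻(0.57) bounded the
bulk `∫₀^{2b} w·D` by a zeroth-order Riemann sum over 2,280 cells (kernel loss `5·10⁻³·‖G‖²`), which cannot resolve
the margins `10⁻⁵ … 10⁻⁶ ·‖G‖²` of the planned rungs `0.560 … 0.558` (cc-s2-2 MEMO §4).  Here the bulk is bounded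
with NO cells:

* `mul_weilArchDensity_le` (LEMMA A): for `0 < t ≤ 2` and parameters `n ≥ 1`, `m`, `K`,
  `t·w(t) ≤ ½ · E_n(t/2) · A_m(u_K(t))`, where `E_n(x) = Σ_{j<n} x^j/j! + x^n (n+1)/(n!·n) ≥ e^x` on `[0,1]`
  (`Real.exp_bound'`), `u_K(t) = Σ_{k<K} t^{2k+2}/(2k+3)! ≤ sinh(t)/t − 1` (`Real.hasSum_sinh`, positive terms) and
  `A_m(u) = Σ_{i ≤ 2m} (−u)^i ≥ 1/(1+u)` for `u ≥ 0` (odd partial sums of the geometric series overshoot).  All three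
  factors are polynomials with rational coefficients; `archMajorL n m K : List ℚ` is their product as a
  kernel-computable coefficient list (`ev_archMajorL`).  Accuracy: relative error
  `≈ (t/2)^n/n! + u^{2m+1} + t^{2K+2}/(2K+3)!`, e.g. `< 10⁻⁹` on `[0, 1.2]` for `(n, m, K) = (14, 7, 5)`.
* `setIntegral_weilArchDensity_mul_le` (THEOREM B): if on `(0, T]`, `T ≤ 2`, a function `D` factors as
  `D(t) = t · q(t)` with `q` a rational list polynomial, `q ≥ 0` there, then `w·D` is integrable on `(0, T]` and
  `∫_{(0,T]} w·D ≤ evQ (integ (archMajorL n m K · q)) T` — ONE rational number, evaluated by the kernel.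
  For a polynomial Markov witness `G = p·1_{[−b,b]}` the increment `D_t(G)` is such a `t·q(t)` on `(0, 2b]`
  (`SemilocalPolyWitness.lean`: `incrementL`, constant coefficient `0`, `D ≥ 0`).

References: E. Bombieri, Rend. Mat. Acc. Lincei (9) 11 (2000) Thm 2 (the density `x dx/(x²−1)`); for the three
inequalities: folklore (Taylor remainder of `exp`, the sinh series, alternating geometric sums).
-/

set_option linter.dupNamespace false  -- the mandated namespace repeats `RiemannHypothesis`

noncomputable section

open MeasureTheory Set Finset Real
open Literature.NumberTheory.LFunctions

namespace Summit.RiemannHypothesis.RiemannHypothesis.Theorems.SemilocalPolyWitness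

open LQ

/-! ## The three elementary majorants (real side) -/

/-- `u_K(t) = Σ_{k<K} t^{2k+2}/(2k+3)!` — the sinh series without its first term, divided by `t`, truncated. -/
def uSum (K : ℕ) (t : ℝ) : ℝ := ∑ k ∈ range K, t ^ (2 * k + 2) / (2 * k + 3).factorial

/-- `u_K(t) ≥ 0` for `t ≥ 0`. -/
theorem uSum_nonneg (K : ℕ) {t : ℝ} (ht : 0 ≤ t) : 0 ≤ uSum K t :=
  Finset.sum_nonneg fun k _ ↦ by positivity

/-- **sinh minorant**: `t (1 + u_K(t)) ≤ sinh t` for `t ≥ 0` (partial sums of a series of non-negative terms). -/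
theorem mul_one_add_uSum_le_sinh (K : ℕ) {t : ℝ} (ht : 0 ≤ t) : t * (1 + uSum K t) ≤ Real.sinh t := by
  have h := sum_le_hasSum (range (K + 1)) (fun n _ ↦ by positivity) (Real.hasSum_sinh t)
  have e : ∑ n ∈ range (K + 1), t ^ (2 * n + 1) / ((2 * n + 1).factorial : ℝ) = t * (1 + uSum K t) := by
    rw [Finset.sum_range_succ', uSum, mul_add, Finset.mul_sum]
    simp only [Nat.mul_zero, zero_add, pow_one, Nat.factorial_one, Nat.cast_one, div_one, mul_one]
    rw [add_comm]
    congr 1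
    refine Finset.sum_congr rfl fun k _ ↦ ?_
    rw [show 2 * (k + 1) + 1 = 2 * k + 3 by ring, show t ^ (2 * k + 3) = t * t ^ (2 * k + 2) by ring]
    ring
  rw [← e]
  exact h

/-- `E_n(x) = Σ_{j<n} x^j/j! + x^n (n+1)/(n!·n)`. -/
def expUp (n : ℕ) (x : ℝ) : ℝ :=
  (∑ j ∈ range n, x ^ j / j.factorial) + x ^ n * (n + 1) / (n.factorial * n)

/-- **exp majorant**: `e^x ≤ E_n(x)` for `0 ≤ x ≤ 1`, `n ≥ 1`. -/
theorem exp_le_expUp {n : ℕ} (hn : 0 < n) {x : ℝ} (h0 : 0 ≤ x) (h1 : x ≤ 1) : Real.exp x ≤ expUp n x :=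
  Real.exp_bound' h0 h1 hn

/-- `A_m(u) = Σ_{i<2m+1} (−u)^i`. -/
def geomAlt (m : ℕ) (u : ℝ) : ℝ := ∑ i ∈ range (2 * m + 1), (-u) ^ i

/-- `(1 + u) A_m(u) = 1 + u^{2m+1}`. -/
theorem one_add_mul_geomAlt (m : ℕ) (u : ℝ) : (1 + u) * geomAlt m u = 1 + u ^ (2 * m + 1) := by
  have h := geom_sum_mul (-u) (2 * m + 1)
  rw [geomAlt]
  have e : (-u) ^ (2 * m + 1) = -u ^ (2 * m + 1) := Odd.neg_pow ⟨m, rfl⟩ u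
  rw [e] at h
  linear_combination -h

/-- **geometric majorant**: `1/(1+u) ≤ A_m(u)` for `u ≥ 0`. -/
theorem inv_one_add_le_geomAlt (m : ℕ) {u : ℝ} (hu : 0 ≤ u) : 1 / (1 + u) ≤ geomAlt m u := by
  rw [div_le_iff₀ (by linarith), mul_comm, one_add_mul_geomAlt]
  have : 0 ≤ u ^ (2 * m + 1) := by positivity
  linarith

/-- `A_m(u) > 0` for `u ≥ 0`. -/
theorem geomAlt_pos (m : ℕ) {u : ℝ} (hu : 0 ≤ u) : 0 < geomAlt m u :=
  lt_of_lt_of_le (by positivity) (inv_one_add_le_geomAlt m hu)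

/-- **LEMMA A — polynomial majorant of `t·w(t)`**: for `0 < t ≤ 2`, `n ≥ 1`,
`t · w(t) ≤ ½ · E_n(t/2) · A_m(u_K(t))`. -/
theorem mul_weilArchDensity_le (n m K : ℕ) (hn : 0 < n) {t : ℝ} (ht : 0 < t) (ht2 : t ≤ 2) :
    t * weilArchDensity t ≤ 1 / 2 * expUp n (t / 2) * geomAlt m (uSum K t) := by
  have hsinh : 0 < Real.sinh t := Real.sinh_pos_iff.2 ht
  have hu := uSum_nonneg K ht.le
  -- t / sinh t ≤ 1/(1+u) ≤ A_m(u)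
  have h1 : t / Real.sinh t ≤ 1 / (1 + uSum K t) := by
    rw [div_le_div_iff₀ hsinh (by linarith), one_mul]
    exact mul_one_add_uSum_le_sinh K ht.le
  have h2 : t / Real.sinh t ≤ geomAlt m (uSum K t) := h1.trans (inv_one_add_le_geomAlt m hu)
  have h3 : Real.exp (t / 2) ≤ expUp n (t / 2) := exp_le_expUp hn (by linarith) (by linarith)
  have hE : 0 ≤ expUp n (t / 2) := (Real.exp_pos _).le.trans h3
  have e : t * weilArchDensity t = 1 / 2 * Real.exp (t / 2) * (t / Real.sinh t) := by
    unfold weilArchDensity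
    field_simp
  rw [e]
  have hts : 0 ≤ t / Real.sinh t := by positivity
  calc 1 / 2 * Real.exp (t / 2) * (t / Real.sinh t)
      ≤ 1 / 2 * expUp n (t / 2) * (t / Real.sinh t) := by gcongr
    _ ≤ 1 / 2 * expUp n (t / 2) * geomAlt m (uSum K t) := by gcongr

/-! ## The majorant as a kernel-computable coefficient list -/

/-- The list of `u_K(t)`. -/
def uSumL : ℕ → List ℚ
  | 0 => []
  | K + 1 => add (uSumL K) (smul (1 / (2 * K + 3).factorial) (pow [0, 1] (2 * K + 2)))

/-- `ev [0, 1] t = t`. -/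
theorem ev_X (t : ℝ) : ev [0, 1] t = t := by simp

/-- `ev (uSumL K) = u_K`. -/
theorem ev_uSumL : ∀ (K : ℕ) (t : ℝ), ev (uSumL K) t = uSum K t
  | 0, t => by simp [uSumL, uSum]
  | K + 1, t => by
      rw [uSumL, ev_add, ev_smul, ev_pow, ev_X, ev_uSumL K t, uSum, uSum, Finset.sum_range_succ]
      push_cast
      ring

/-- The list of `Σ_{j<n} (t/2)^j/j!`. -/
def expPartL : ℕ → List ℚ
  | 0 => []
  | j + 1 => add (expPartL j) (smul ((1 / 2) ^ j / j.factorial) (pow [0, 1] j))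

/-- `ev (expPartL n) t = Σ_{j<n} (t/2)^j/j!`. -/
theorem ev_expPartL : ∀ (n : ℕ) (t : ℝ), ev (expPartL n) t = ∑ j ∈ range n, (t / 2) ^ j / j.factorial
  | 0, t => by simp [expPartL]
  | j + 1, t => by
      rw [expPartL, ev_add, ev_smul, ev_pow, ev_X, ev_expPartL j t, Finset.sum_range_succ]
      congr 1
      push_cast
      simp only [div_pow, one_div, inv_pow]
      ring

/-- The list of `E_n(t/2)`. -/
def expUpHalfL (n : ℕ) : List ℚ :=
  add (expPartL n) (smul ((1 / 2) ^ n * (n + 1) / (n.factorial * n)) (pow [0, 1] n))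

/-- `ev (expUpHalfL n) t = E_n(t/2)`. -/
theorem ev_expUpHalfL (n : ℕ) (t : ℝ) : ev (expUpHalfL n) t = expUp n (t / 2) := by
  rw [expUpHalfL, ev_add, ev_smul, ev_pow, ev_X, ev_expPartL, expUp]
  congr 1
  push_cast
  simp only [div_pow, one_div, inv_pow]
  ring

/-- The list of `Σ_{i<N} (−u)^i` for a list `u`. -/
def geomL : ℕ → List ℚ → List ℚ
  | 0, _ => []
  | i + 1, u => add (geomL i u) (pow (neg u) i)

/-- `ev (geomL N u) t = Σ_{i<N} (−ev u t)^i`. -/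
theorem ev_geomL : ∀ (N : ℕ) (u : List ℚ) (t : ℝ), ev (geomL N u) t = ∑ i ∈ range N, (-ev u t) ^ i
  | 0, u, t => by simp [geomL]
  | i + 1, u, t => by
      rw [geomL, ev_add, ev_pow, ev_neg, ev_geomL i u t, Finset.sum_range_succ]

/-- **The majorant list** `archMajorL n m K`: coefficients of `½ · E_n(t/2) · A_m(u_K(t))`. -/
def archMajorL (n m K : ℕ) : List ℚ :=
  smul (1 / 2) (mul (expUpHalfL n) (geomL (2 * m + 1) (uSumL K)))

/-- `ev (archMajorL n m K) t = ½ · E_n(t/2) · A_m(u_K(t))`. -/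
theorem ev_archMajorL (n m K : ℕ) (t : ℝ) :
    ev (archMajorL n m K) t = 1 / 2 * expUp n (t / 2) * geomAlt m (uSum K t) := by
  rw [archMajorL, ev_smul, ev_mul, ev_expUpHalfL, ev_geomL, ev_uSumL, geomAlt]
  push_cast
  ring

/-- LEMMA A in list form: `t·w(t) ≤ ev (archMajorL n m K) t` on `(0, 2]`. -/
theorem mul_weilArchDensity_le_ev (n m K : ℕ) (hn : 0 < n) {t : ℝ} (ht : 0 < t) (ht2 : t ≤ 2) :
    t * weilArchDensity t ≤ ev (archMajorL n m K) t := by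
  rw [ev_archMajorL]
  exact mul_weilArchDensity_le n m K hn ht ht2

/-! ## THEOREM B: the bulk integral against a polynomial increment -/

/-- `ev (integ l) 0 = 0`. -/
theorem ev_integ_zero (l : List ℚ) : ev (integ l) 0 = 0 := by
  rw [integ, ev_cons]; simp

/-- **THEOREM B.**  Let `0 < T ≤ 2` be rational and let `D` agree on `(0, T]` with `t · q(t)`, `q` a rational
coefficient list with `q ≥ 0` there.  Then `w·D` is integrable on `(0, T]` and
`∫_{(0,T]} w·D ≤ evQ (integ (archMajorL n m K · q)) T` — a rational number the kernel evaluates.  (No measurability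
hypothesis on `D`: on `(0, T]` it IS the polynomial.) -/
theorem setIntegral_weilArchDensity_mul_le {q : List ℚ} {D : ℝ → ℝ} {T : ℚ} (hT0 : 0 < T) (hT2 : (T : ℝ) ≤ 2)
    (hD : ∀ t ∈ Ioc (0 : ℝ) T, D t = t * ev q t) (hq : ∀ t ∈ Ioc (0 : ℝ) T, 0 ≤ ev q t)
    (n m K : ℕ) (hn : 0 < n) :
    IntegrableOn (fun t ↦ weilArchDensity t * D t) (Ioc (0 : ℝ) T) ∧
      ∫ t in Ioc (0 : ℝ) T, weilArchDensity t * D t ≤ ((evQ (integ (mul (archMajorL n m K) q)) T : ℚ) : ℝ) := by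
  have hT0' : (0 : ℝ) < T := by exact_mod_cast hT0
  set M : ℝ → ℝ := fun t ↦ ev (mul (archMajorL n m K) q) t with hM
  set P : ℝ → ℝ := fun t ↦ weilArchDensity t * (t * ev q t) with hP
  have hMc : Continuous M := continuous_ev _
  have hMi : IntegrableOn M (Ioc (0 : ℝ) T) :=
    (hMc.integrableOn_Icc (a := 0) (b := (T : ℝ))).mono_set Ioc_subset_Icc_self
  have hEq : EqOn (fun t ↦ weilArchDensity t * D t) P (Ioc (0 : ℝ) T) := fun t ht ↦ by
    simp only [hP, hD t ht]
  -- pointwise: 0 ≤ P ≤ M on (0, T]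
  have hpt : ∀ t ∈ Ioc (0 : ℝ) T, 0 ≤ P t ∧ P t ≤ M t := by
    intro t ht
    have hw := weilArchDensity_pos ht.1
    have hqt := hq t ht
    refine ⟨mul_nonneg hw.le (mul_nonneg ht.1.le hqt), ?_⟩
    rw [hM, hP]
    simp only
    rw [ev_mul, show weilArchDensity t * (t * ev q t) = (t * weilArchDensity t) * ev q t by ring]
    exact mul_le_mul_of_nonneg_right (mul_weilArchDensity_le_ev n m K hn ht.1 (ht.2.trans hT2)) hqt
  have hPm : AEStronglyMeasurable P (volume.restrict (Ioc (0 : ℝ) T)) := by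
    have : Measurable P := by
      rw [hP]
      exact measurable_weilArchDensity.mul (measurable_id.mul (continuous_ev q).measurable)
    exact this.aestronglyMeasurable
  have hPint : IntegrableOn P (Ioc (0 : ℝ) T) := by
    refine Integrable.mono' hMi hPm ?_
    filter_upwards [ae_restrict_mem measurableSet_Ioc] with t ht
    rw [Real.norm_eq_abs, abs_of_nonneg (hpt t ht).1]
    exact (hpt t ht).2
  have hint : IntegrableOn (fun t ↦ weilArchDensity t * D t) (Ioc (0 : ℝ) T) := hPint.congr_fun hEq.symm measurableSet_Ioc
  refine ⟨hint, ?_⟩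
  calc ∫ t in Ioc (0 : ℝ) T, weilArchDensity t * D t
      = ∫ t in Ioc (0 : ℝ) T, P t := setIntegral_congr_fun measurableSet_Ioc hEq
    _ ≤ ∫ t in Ioc (0 : ℝ) T, M t := setIntegral_mono_on hPint hMi measurableSet_Ioc fun t ht ↦ (hpt t ht).2
    _ = ∫ t in (0 : ℝ)..T, M t := (intervalIntegral.integral_of_le hT0'.le).symm
    _ = ((evQ (integ (mul (archMajorL n m K) q)) T : ℚ) : ℝ) := by
        rw [hM, integral_ev, ev_integ_zero, sub_zero, ev_ratCast]

/-! ## Kernel regression (the lists reduce) -/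

/-- `u_1(t) = t²/6`, `E_1(t/2) = 1 + (t/2)·2 = 1 + t`, `A_0 = 1`: `archMajorL 1 0 1 = ½(1 + t)`
(lad-2's crude bound `t·w(t) ≤ ½ + t/2`… here `≤ ½ + t/2`, cf. `mul_weilArchDensity_le`). -/
example : evQ (archMajorL 1 0 1) 1 = 1 ∧ evQ (archMajorL 1 0 1) 0 = 1 / 2 := by decide +kernel

end Summit.RiemannHypothesis.RiemannHypothesis.Theorems.SemilocalPolyWitness

end
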